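import Mathlib
import Summits.Ventures.PercRepro.TriangleCapAvoid

/-!
# PercRepro — the side cases of the row `m = k + 2`: a lone matching pair is impossible, a dominating vertex sees
every pair off it as a matching pair, the Erdős–Ko–Rado step for a family of edges, and the defect sum at a
vertex of maximum degree `4` (p3, gen 31; part 2 of the row `m = k + 2`)

* `two_le_card_T_of_pos` — the matching pairs come with their swaps: `T ≠ 1`;
* `adj_of_deg_add_one_eq_card`, `filter_T_eq_offPairs_of_deg_add_one_eq_card` — `d(v) = k − 1` ⇒ `v` sees every
  other vertex and every pair off `v` is a matching pair (`T = |R|`);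
* `exists_common_vertex_of_pairwise_inter` — a pairwise intersecting family of `≥ 4` edges has a common vertex
  (TriangleCapPairwise's argument for an arbitrary sub-family of the edges);
* `offEdges D v` — the edges not at `v`, `card_offEdges` (`= m − d(v)`);
* `four_le_sum_avoid_of_disjoint_edges` — two disjoint edges off `v` give `Y ≥ 4`;
* `card_offEdges_add_one_le_deg_of_common_vertex` — a common vertex `c ∈ N(v)` of the edges off `v` has
  `d(c) ≥ |E'| + 1`;
* **`four_le_sum_avoid_of_max_deg`** — at a vertex `v` of maximum degree with `d(v) ≤ |E'|`, `4 ≤ |E'|` and a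
  matching pair, `Y ≥ 4` (two disjoint edges off `v`, or a common vertex of degree `> d(v)`).

Axioms: standard.
-/

namespace PercRepro

namespace TriangleCap

namespace C047

open Finset

variable {V : Type*} [Fintype V] [DecidableEq V]

/-- A matching pair comes with its swap: `0 < T` ⇒ `2 ≤ T`. -/
theorem two_le_card_T_of_pos (D : SimpleGraph V) [DecidableRel D.Adj] (v : V)
    (hT : 0 < ((offPairs D v).filter (fun p => D.Adj v p.1 ∧ D.Adj v p.2)).card) :
    2 ≤ ((offPairs D v).filter (fun p => D.Adj v p.1 ∧ D.Adj v p.2)).card := by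
  obtain ⟨p, hp⟩ := card_pos.mp hT
  have hp' := hp
  rw [mem_filter] at hp'
  have hps : p.swap ∈ (offPairs D v).filter (fun p => D.Adj v p.1 ∧ D.Adj v p.2) := by
    rw [mem_filter, Prod.fst_swap, Prod.snd_swap]
    exact ⟨swap_mem_offPairs D v hp'.1, hp'.2.2, hp'.2.1⟩
  have hne : p ≠ p.swap := by
    intro h
    have h1 : p.1 = p.2 := by
      have := congrArg Prod.fst h
      rwa [Prod.fst_swap] at this
    exact D.ne_of_adj ((mem_offPairs D v p).mp hp'.1).1 h1
  have hsub : ({p, p.swap} : Finset (V × V)) ⊆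
      (offPairs D v).filter (fun p => D.Adj v p.1 ∧ D.Adj v p.2) := by
    intro q hq
    rw [mem_insert, mem_singleton] at hq
    rcases hq with rfl | rfl
    · exact hp
    · exact hps
  have := card_le_card hsub
  rwa [card_pair hne] at this

/-- A vertex of degree `k − 1` sees every other vertex. -/
theorem adj_of_deg_add_one_eq_card (D : SimpleGraph V) [DecidableRel D.Adj] {v : V}
    (hd : deg D v + 1 = Fintype.card V) {w : V} (hw : w ≠ v) : D.Adj v w := by
  have hsub : univ.filter (fun w => D.Adj v w) ⊆ univ.erase v := by
    intro x hx
    rw [mem_filter] at hx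
    rw [mem_erase]
    exact ⟨(D.ne_of_adj hx.2).symm, mem_univ _⟩
  have hcard : (univ.erase v).card ≤ (univ.filter (fun w => D.Adj v w)).card := by
    rw [card_erase_of_mem (mem_univ v), card_univ]
    unfold deg at hd
    omega
  have heq := eq_of_subset_of_card_le hsub hcard
  have hw' : w ∈ univ.erase v := mem_erase.mpr ⟨hw, mem_univ _⟩
  rw [← heq, mem_filter] at hw'
  exact hw'.2

/-- At a vertex of degree `k − 1` every pair off `v` is a matching pair: `T = |R|`. -/
theorem filter_T_eq_offPairs_of_deg_add_one_eq_card (D : SimpleGraph V) [DecidableRel D.Adj] {v : V}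
    (hd : deg D v + 1 = Fintype.card V) :
    (offPairs D v).filter (fun p => D.Adj v p.1 ∧ D.Adj v p.2) = offPairs D v := by
  apply filter_true_of_mem
  intro p hp
  rw [mem_offPairs] at hp
  exact ⟨adj_of_deg_add_one_eq_card D hd hp.2.1, adj_of_deg_add_one_eq_card D hd hp.2.2⟩

/-- **Pairwise intersecting edges, at least four of them, share a vertex** (TriangleCapPairwise's argument
for a sub-family `F` of the edges). -/
theorem exists_common_vertex_of_pairwise_inter (D : SimpleGraph V) [DecidableRel D.Adj]
    (F : Finset (Sym2 V)) (hF : F ⊆ D.edgeFinset)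
    (hpa : ∀ e ∈ F, ∀ f ∈ F, e ≠ f → ∃ x, x ∈ e ∧ x ∈ f) (h4 : 4 ≤ F.card) :
    ∃ c : V, ∀ e ∈ F, c ∈ e := by
  obtain ⟨e₁, he₁⟩ : F.Nonempty := card_pos.mp (by omega)
  revert he₁
  refine Sym2.ind (fun a b => ?_) e₁
  intro hab
  have hne_ab : a ≠ b := (D.mem_edgeSet.mp (SimpleGraph.mem_edgeFinset.mp (hF hab))).ne
  by_cases hA : ∀ e ∈ F, a ∈ e
  · exact ⟨a, hA⟩
  by_cases hB : ∀ e ∈ F, b ∈ e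
  · exact ⟨b, hB⟩
  exfalso
  push Not at hA hB
  obtain ⟨f, hf, hfa⟩ := hA
  obtain ⟨g, hg, hgb⟩ := hB
  -- `f` misses `a`, so it meets `s(a, b)` in `b`
  have hfb : b ∈ f := by
    have hne : s(a, b) ≠ f := fun h => hfa (h ▸ Sym2.mem_mk_left a b)
    obtain ⟨z, hz1, hz2⟩ := hpa _ hab f hf hne
    rcases Sym2.mem_iff.mp hz1 with rfl | rfl
    · exact absurd hz2 hfa
    · exact hz2
  -- `g` misses `b`, so it meets `s(a, b)` in `a`
  have hga : a ∈ g := by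
    have hne : s(a, b) ≠ g := fun h => hgb (h ▸ Sym2.mem_mk_right a b)
    obtain ⟨z, hz1, hz2⟩ := hpa _ hab g hg hne
    rcases Sym2.mem_iff.mp hz1 with rfl | rfl
    · exact hz2
    · exact absurd hz2 hgb
  -- `f = s(b, x)` with `x ∉ {a, b}`
  obtain ⟨x, rfl⟩ := Sym2.mem_iff_exists.mp hfb
  have hxa : x ≠ a := fun h => hfa (h ▸ Sym2.mem_mk_right b x)
  have hxb : x ≠ b := (D.mem_edgeSet.mp (SimpleGraph.mem_edgeFinset.mp (hF hf))).ne.symm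
  -- `g` meets `s(b, x)` off `b`, so `x ∈ g` and `g = s(a, x)`: a triangle
  have hgx : x ∈ g := by
    have hne : g ≠ s(b, x) := fun h => hgb (h ▸ Sym2.mem_mk_left b x)
    obtain ⟨z, hz1, hz2⟩ := hpa _ hg _ hf hne
    rcases Sym2.mem_iff.mp hz2 with rfl | rfl
    · exact absurd hz1 hgb
    · exact hz1
  have hg' : g = s(a, x) := (Sym2.mem_and_mem_iff hxa.symm).mp ⟨hga, hgx⟩
  subst hg'
  -- a fourth edge `h` outside the triangle
  set T : Finset (Sym2 V) := {s(a, b), s(b, x), s(a, x)} with hT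
  have hT3 : T.card ≤ 3 := by
    have h1 := card_insert_le (s(a, b)) ({s(b, x), s(a, x)} : Finset (Sym2 V))
    have h2 := card_insert_le (s(b, x)) ({s(a, x)} : Finset (Sym2 V))
    rw [card_singleton] at h2
    rw [hT]
    omega
  have hne' : (F \ T).Nonempty := by
    rw [← card_pos]
    have := card_le_card_sdiff_add_card (s := F) (t := T)
    omega
  obtain ⟨h, hh⟩ := hne'
  rw [mem_sdiff] at hh
  obtain ⟨hhE, hhT⟩ := hh
  have hh1 : h ≠ s(a, b) := fun e => hhT (by rw [e, hT]; simp)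
  have hh2 : h ≠ s(b, x) := fun e => hhT (by rw [e, hT]; simp)
  have hh3 : h ≠ s(a, x) := fun e => hhT (by rw [e, hT]; simp)
  -- `h` meets the three sides of the triangle
  obtain ⟨p₁, hp₁, hp₁h⟩ := hpa _ hab h hhE (Ne.symm hh1)
  obtain ⟨p₂, hp₂, hp₂h⟩ := hpa _ hf h hhE (Ne.symm hh2)
  obtain ⟨p₃, hp₃, hp₃h⟩ := hpa _ hg h hhE (Ne.symm hh3)
  rcases Sym2.mem_iff.mp hp₁ with rfl | rfl <;> rcases Sym2.mem_iff.mp hp₂ with rfl | rfl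
  · exact hh1 ((Sym2.mem_and_mem_iff hne_ab).mp ⟨hp₁h, hp₂h⟩)
  · exact hh3 ((Sym2.mem_and_mem_iff hxa.symm).mp ⟨hp₁h, hp₂h⟩)
  · rcases Sym2.mem_iff.mp hp₃ with rfl | rfl
    · exact hh1 ((Sym2.mem_and_mem_iff hne_ab).mp ⟨hp₃h, hp₁h⟩)
    · exact hh2 ((Sym2.mem_and_mem_iff hxb.symm).mp ⟨hp₁h, hp₃h⟩)
  · exact hh2 ((Sym2.mem_and_mem_iff hxb.symm).mp ⟨hp₁h, hp₂h⟩)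

/-! ### The edges off a vertex -/

/-- The edges of `D` not containing `v`. -/
def offEdges (D : SimpleGraph V) [DecidableRel D.Adj] (v : V) : Finset (Sym2 V) :=
  D.edgeFinset.filter (fun e => v ∉ e)

/-- Membership in `offEdges`. -/
theorem mem_offEdges (D : SimpleGraph V) [DecidableRel D.Adj] (v : V) (e : Sym2 V) :
    e ∈ offEdges D v ↔ e ∈ D.edgeFinset ∧ v ∉ e := by
  unfold offEdges
  rw [mem_filter]

/-- The edges off `v` are the edges minus the incidence set of `v`. -/
theorem offEdges_eq_sdiff (D : SimpleGraph V) [DecidableRel D.Adj] (v : V) :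
    offEdges D v = D.edgeFinset \ D.incidenceFinset v := by
  ext e
  rw [mem_offEdges, mem_sdiff, SimpleGraph.mem_incidenceFinset]
  constructor
  · rintro ⟨he, hv⟩
    exact ⟨he, fun h => hv h.2⟩
  · rintro ⟨he, hv⟩
    exact ⟨he, fun h => hv ⟨SimpleGraph.mem_edgeFinset.mp he, h⟩⟩

/-- `|E'| = m − d(v)`. -/
theorem card_offEdges (D : SimpleGraph V) [DecidableRel D.Adj] (v : V) :
    (offEdges D v).card = D.edgeFinset.card - deg D v := by
  rw [offEdges_eq_sdiff, card_sdiff_of_subset (D.incidenceFinset_subset v), deg_eq_card_incidenceFinset]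

/-- The edge of a matching pair is an edge off `v`. -/
theorem mk_mem_offEdges_of_mem_offPairs (D : SimpleGraph V) [DecidableRel D.Adj] (v : V) {p : V × V}
    (hp : p ∈ offPairs D v) : s(p.1, p.2) ∈ offEdges D v := by
  rw [mem_offPairs] at hp
  rw [mem_offEdges]
  refine ⟨SimpleGraph.mem_edgeFinset.mpr hp.1, ?_⟩
  intro hm
  rcases Sym2.mem_iff.mp hm with hm | hm
  · exact hp.2.1 hm.symm
  · exact hp.2.2 hm.symm

/-- **Two disjoint edges off `v` give `Y ≥ 4`:** each of their four orientations is a pair off `v` whose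
`avoid` set contains the other edge. -/
theorem four_le_sum_avoid_of_disjoint_edges (D : SimpleGraph V) [DecidableRel D.Adj] (v : V)
    {e₁ e₂ : Sym2 V} (he₁ : e₁ ∈ offEdges D v) (he₂ : e₂ ∈ offEdges D v)
    (hdisj : ∀ x, x ∈ e₁ → x ∉ e₂) :
    4 ≤ ∑ p ∈ offPairs D v, (avoid D v p).card := by
  revert he₁ he₂ hdisj
  refine Sym2.ind (fun a b => ?_) e₁
  refine Sym2.ind (fun c d => ?_) e₂
  intro hab hcd hdisj
  rw [mem_offEdges] at hab hcd
  have hab' : D.Adj a b := D.mem_edgeSet.mp (SimpleGraph.mem_edgeFinset.mp hab.1)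
  have hcd' : D.Adj c d := D.mem_edgeSet.mp (SimpleGraph.mem_edgeFinset.mp hcd.1)
  have hav : a ≠ v := fun h => hab.2 (h ▸ Sym2.mem_mk_left a b)
  have hbv : b ≠ v := fun h => hab.2 (h ▸ Sym2.mem_mk_right a b)
  have hcv : c ≠ v := fun h => hcd.2 (h ▸ Sym2.mem_mk_left c d)
  have hdv : d ≠ v := fun h => hcd.2 (h ▸ Sym2.mem_mk_right c d)
  have ha : a ∉ s(c, d) := hdisj a (Sym2.mem_mk_left a b)
  have hb : b ∉ s(c, d) := hdisj b (Sym2.mem_mk_right a b)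
  have hc : c ∉ s(a, b) := fun h => hdisj c h (Sym2.mem_mk_left c d)
  have hd : d ∉ s(a, b) := fun h => hdisj d h (Sym2.mem_mk_right c d)
  have hne_ab : a ≠ b := D.ne_of_adj hab'
  have hne_cd : c ≠ d := D.ne_of_adj hcd'
  have hac : a ≠ c := fun h => ha (h ▸ Sym2.mem_mk_left c d)
  have had : a ≠ d := fun h => ha (h ▸ Sym2.mem_mk_right c d)
  have hbc : b ≠ c := fun h => hb (h ▸ Sym2.mem_mk_left c d)
  have hbd : b ≠ d := fun h => hb (h ▸ Sym2.mem_mk_right c d)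
  -- the four pairs
  have h1 : (a, b) ∈ offPairs D v := (mem_offPairs D v _).mpr ⟨hab', hav, hbv⟩
  have h2 : (b, a) ∈ offPairs D v := (mem_offPairs D v _).mpr ⟨hab'.symm, hbv, hav⟩
  have h3 : (c, d) ∈ offPairs D v := (mem_offPairs D v _).mpr ⟨hcd', hcv, hdv⟩
  have h4 : (d, c) ∈ offPairs D v := (mem_offPairs D v _).mpr ⟨hcd'.symm, hdv, hcv⟩
  -- the avoid sets are non-empty
  have hA1 : s(c, d) ∈ avoid D v (a, b) := (mem_avoid D v _ _).mpr ⟨hcd.1, hcd.2, ha, hb⟩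
  have hA2 : s(c, d) ∈ avoid D v (b, a) := (mem_avoid D v _ _).mpr ⟨hcd.1, hcd.2, hb, ha⟩
  have hA3 : s(a, b) ∈ avoid D v (c, d) := (mem_avoid D v _ _).mpr ⟨hab.1, hab.2, hc, hd⟩
  have hA4 : s(a, b) ∈ avoid D v (d, c) := (mem_avoid D v _ _).mpr ⟨hab.1, hab.2, hd, hc⟩
  set S : Finset (V × V) := {(a, b), (b, a), (c, d), (d, c)} with hS
  have hsub : S ⊆ offPairs D v := by
    intro p hp
    rw [hS, mem_insert, mem_insert, mem_insert, mem_singleton] at hp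
    rcases hp with rfl | rfl | rfl | rfl
    · exact h1
    · exact h2
    · exact h3
    · exact h4
  have hScard : S.card = 4 := by
    rw [hS, card_insert_of_notMem, card_insert_of_notMem, card_pair]
    · intro h
      rw [Prod.mk.injEq] at h
      exact hne_cd h.1
    · rw [mem_insert, mem_singleton, Prod.mk.injEq, Prod.mk.injEq]
      rintro (⟨h, -⟩ | ⟨h, -⟩)
      · exact hbc h
      · exact hbd h
    · rw [mem_insert, mem_insert, mem_singleton, Prod.mk.injEq, Prod.mk.injEq, Prod.mk.injEq]
      rintro (⟨h, -⟩ | ⟨h, -⟩ | ⟨h, -⟩)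
      · exact hne_ab h
      · exact hac h
      · exact had h
  have hone : ∀ p ∈ S, 1 ≤ (avoid D v p).card := by
    intro p hp
    rw [hS, mem_insert, mem_insert, mem_insert, mem_singleton] at hp
    rcases hp with rfl | rfl | rfl | rfl
    · exact card_pos.mpr ⟨_, hA1⟩
    · exact card_pos.mpr ⟨_, hA2⟩
    · exact card_pos.mpr ⟨_, hA3⟩
    · exact card_pos.mpr ⟨_, hA4⟩
  have hsum := card_nsmul_le_sum S (fun p => (avoid D v p).card) 1 hone
  rw [hScard, smul_eq_mul, mul_one] at hsum
  exact hsum.trans (sum_le_sum_of_subset hsub)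

/-- A common vertex `c ~ v` of the edges off `v` has `d(c) ≥ |E'| + 1`. -/
theorem card_offEdges_add_one_le_deg_of_common_vertex (D : SimpleGraph V) [DecidableRel D.Adj] {v c : V}
    (hvc : D.Adj v c) (hc : ∀ e ∈ offEdges D v, c ∈ e) : (offEdges D v).card + 1 ≤ deg D c := by
  have hnot : s(v, c) ∉ offEdges D v := by
    rw [mem_offEdges]
    intro h
    exact h.2 (Sym2.mem_mk_left v c)
  have hsub : insert s(v, c) (offEdges D v) ⊆ D.incidenceFinset c := by
    intro e he
    rw [mem_insert] at he
    rw [SimpleGraph.mem_incidenceFinset]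
    rcases he with rfl | he
    · exact ⟨D.mem_edgeSet.mpr hvc, Sym2.mem_mk_right v c⟩
    · rw [mem_offEdges] at he
      exact ⟨SimpleGraph.mem_edgeFinset.mp he.1, hc e ((mem_offEdges D v e).mpr he)⟩
  have := card_le_card hsub
  rw [card_insert_of_notMem hnot, ← deg_eq_card_incidenceFinset] at this
  exact this

/-- **The defect sum at a vertex of maximum degree with `d(v) ≤ |E'|`, `4 ≤ |E'|` and a matching pair is
at least `4`:** two disjoint edges off `v`, or else a common vertex of degree `> d(v)`. -/
theorem four_le_sum_avoid_of_max_deg (D : SimpleGraph V) [DecidableRel D.Adj] (v : V)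
    (hmax : ∀ u, deg D u ≤ deg D v) (hE4 : 4 ≤ (offEdges D v).card)
    (hdE : deg D v ≤ (offEdges D v).card)
    (hT : 0 < ((offPairs D v).filter (fun p => D.Adj v p.1 ∧ D.Adj v p.2)).card) :
    4 ≤ ∑ p ∈ offPairs D v, (avoid D v p).card := by
  by_cases hpa : ∀ e ∈ offEdges D v, ∀ f ∈ offEdges D v, e ≠ f → ∃ x, x ∈ e ∧ x ∈ f
  · exfalso
    obtain ⟨c, hc⟩ := exists_common_vertex_of_pairwise_inter D (offEdges D v)
      (fun e he => ((mem_offEdges D v e).mp he).1) hpa hE4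
    obtain ⟨p, hp⟩ := card_pos.mp hT
    rw [mem_filter] at hp
    have hpE := mk_mem_offEdges_of_mem_offPairs D v hp.1
    have hcp := hc _ hpE
    have hvc : D.Adj v c := by
      rcases Sym2.mem_iff.mp hcp with rfl | rfl
      · exact hp.2.1
      · exact hp.2.2
    have h1 := card_offEdges_add_one_le_deg_of_common_vertex D hvc hc
    have h2 := hmax c
    omega
  · push Not at hpa
    obtain ⟨e₁, he₁, e₂, he₂, -, hdisj⟩ := hpa
    exact four_le_sum_avoid_of_disjoint_edges D v he₁ he₂ hdisj

end C047

end TriangleCap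

end PercRepro
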